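import Mathlib
import HarnessLib
import Summits.Ventures.LatticeQCDFlow.Exactness.SphereLatticeHMCExact
import Summits.Ventures.LatticeQCDFlow.Exactness.SphereHMCTangential

/-!
# The CP(N−1)/O(N) HMC as the code runs it — sitewise TANGENT Gaussian momenta — is exact: the lattice configuration chain does not see the normal components

HONEST FRAMING: exact (Metropolis-corrected) sampling algorithms for lattice gauge theory;
figures of merit are autocorrelation/cost numbers at stated couplings and volumes; no
continuum-physics claim.

Venture `LatticeQCDFlow` (cell pub-lqcd), topic `Exactness`; FANOUT row 7 (`s0-cpn-null`: the
S0-D1 rung — 2D CP⁹ HMC/THMC with the E–S §2.2 molecular dynamics on an `L × L` lattice of site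
spheres).  NEW WORK of the cell over the tree's `SphereLatticeHMCExact.lean` (the lattice leapfrog
with ambient momenta is a measure-preserving involution; `lattice_sphere_hmc_gaussian_exact`) and
`SphereHMCTangential.lean` (one-site inertness lemmas; `refreshUpdateK`, refresh from a
position-dependent momentum law).  Nothing is cited as a fact.  Printed counterpart, NAMED ONLY:
Engel–Schaefer, Comput. Phys. Commun. 182 (2011) 2107, §2.2 eqs. (9)–(11) (momenta `π_n` tangent to
each site sphere, kinetic energy `Σ_n |π_n|²/2`, site-coupling forces projected to the tangent
spaces).

This is the lattice counterpart of `SphereHMCTangential.lean`: for a SITEWISE-TANGENT site-coupling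
force (`⟪x_s, F(x)_s⟫ = 0` for all `s`) and the Gaussian kinetic energy `Σ_s ‖p_s‖²/2`, the lattice
proposal commutes with dropping every normal component, the normal components are conserved in
square, `ΔH` does not see them, so the configuration marginal of the phase-space kernel from `(x, p)`
equals the one from the sitewise-tangentialized start, and the configuration kernel with momenta
from ANY law `μP` on `(ℝ^d)^Λ` equals the one with momenta from the sitewise tangent law
`latticeTangentMomentumLaw μP`.  With `lattice_sphere_hmc_gaussian_exact`: the chain the code runs
leaves `e^{−S}·uniformSphere^Λ` invariant.

## Content (`m`, `Λ` finite; `E = EuclideanSpace ℝ m`, `S` its unit sphere)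

* `latticeTangentialize = sitewise tangentialize` (+ `_fst`, `_snd`), `inner_tangentialPart'`;
  `latticeTangentialize_latticeDrift / _latticeFlip / _latticeKick / _leapfrog_pow`,
  **`latticeTangentialize_latticeProposal`**; `inner_latticeLeapfrog_pow`, `inner_sq_latticeProposal`;
  **`energyDiff_latticeProposal_tangentialize`**.
* **`latticeHMC_fst_apply_eq_tangentialize`** (configuration marginal does not see the normal
  components); `latticeTangentMomentumLaw` (+ `_apply`, s-finite / Markov instances,
  `measurable_latticeTangentialize_snd`); **`latticeHMC_config_eq_tangentRefresh`** (THE KERNEL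
  EQUALITY); **`lattice_sphere_hmc_tangentGaussian_exact`** — HMC on the lattice of site spheres
  with sitewise tangent Gaussian momenta, exact geodesic site updates, sitewise-tangent site-coupling
  force, Metropolis and momentum refresh leaves `e^{−S}·uniformSphere^Λ` invariant.

NOT CLAIMED: THMC version through GEN-5's LO sweep (the composition needs `sweepJac > 0` a.e., see
HOME/s0-cpn-null/HANDOFF.md GEN-6 §FOLLOW-UPS); the U(1) link factors; ergodicity; numbers.
-/

noncomputable section

namespace Summit.Ventures.LatticeQCDFlow.Exactness

open MeasureTheory Measure Metric Set Real ProbabilityTheory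
open scoped ENNReal InnerProductSpace

/-! ## Sitewise tangent momenta drive the same configuration chain -/

section LatticeTangential

open ProbabilityTheory

variable {m : Type*} [Fintype m] [DecidableEq m] {Λ : Type*} [Fintype Λ]

/-- Drop the normal momentum component at every site. -/
def latticeTangentialize (z : (Λ → (sphere (0 : EuclideanSpace ℝ m) 1)) × (Λ → (EuclideanSpace ℝ m))) : (Λ → (sphere (0 : EuclideanSpace ℝ m) 1)) × (Λ → (EuclideanSpace ℝ m)) := sitewise tangentialize z

omit [DecidableEq m] [Fintype Λ] in
/-- It fixes the configuration. -/
@[simp] theorem latticeTangentialize_fst (z : (Λ → (sphere (0 : EuclideanSpace ℝ m) 1)) × (Λ → (EuclideanSpace ℝ m))) : (latticeTangentialize z).1 = z.1 := rfl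

omit [DecidableEq m] [Fintype Λ] in
/-- Its momentum at site `s` is the tangential part there. -/
@[simp] theorem latticeTangentialize_snd (z : (Λ → (sphere (0 : EuclideanSpace ℝ m) 1)) × (Λ → (EuclideanSpace ℝ m))) (s : Λ) :
    (latticeTangentialize z).2 s = tangentialPart (z.1 s, z.2 s) := rfl

omit [DecidableEq m] in
/-- The tangential part is tangent (curried form of `inner_tangentialPart`). -/
theorem inner_tangentialPart' (x : (sphere (0 : EuclideanSpace ℝ m) 1)) (p : (EuclideanSpace ℝ m)) : ⟪(x : (EuclideanSpace ℝ m)), tangentialPart (x, p)⟫_ℝ = 0 :=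
  inner_tangentialPart (x, p)

omit [DecidableEq m] [Fintype Λ] in
/-- The lattice drift commutes with sitewise tangentialization. -/
theorem latticeTangentialize_latticeDrift (t : ℝ) (z : (Λ → (sphere (0 : EuclideanSpace ℝ m) 1)) × (Λ → (EuclideanSpace ℝ m))) :
    latticeTangentialize (latticeDrift t z) = latticeDrift t (latticeTangentialize z) := by
  change (sitewise tangentialize ∘ sitewise (ambientDrift t)) z = (sitewise (ambientDrift t) ∘ sitewise tangentialize) z
  rw [← sitewise_comp, ← sitewise_comp]
  have h : (tangentialize ∘ ambientDrift t : (sphere (0 : EuclideanSpace ℝ m) 1) × (EuclideanSpace ℝ m) → (sphere (0 : EuclideanSpace ℝ m) 1) × (EuclideanSpace ℝ m)) = ambientDrift t ∘ tangentialize :=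
    funext fun w => tangentialize_ambientDrift t w
  rw [h]

omit [DecidableEq m] [Fintype Λ] in
/-- The lattice flip commutes with sitewise tangentialization. -/
theorem latticeTangentialize_latticeFlip (z : (Λ → (sphere (0 : EuclideanSpace ℝ m) 1)) × (Λ → (EuclideanSpace ℝ m))) :
    latticeTangentialize (latticeFlip z) = latticeFlip (latticeTangentialize z) := by
  rw [latticeFlip_eq_sitewise]
  change (sitewise tangentialize ∘ sitewise ambientFlip) z = (sitewise ambientFlip ∘ sitewise tangentialize) z
  rw [← sitewise_comp, ← sitewise_comp]
  have h : (tangentialize ∘ ambientFlip : (sphere (0 : EuclideanSpace ℝ m) 1) × (EuclideanSpace ℝ m) → (sphere (0 : EuclideanSpace ℝ m) 1) × (EuclideanSpace ℝ m)) = ambientFlip ∘ tangentialize :=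
    funext fun w => tangentialize_ambientFlip w
  rw [h]

omit [DecidableEq m] [Fintype Λ] in
/-- A SITEWISE-TANGENT site-coupling kick commutes with sitewise tangentialization. -/
theorem latticeTangentialize_latticeKick {F : (Λ → (sphere (0 : EuclideanSpace ℝ m) 1)) → (Λ → (EuclideanSpace ℝ m))}
    (hF : ∀ (x : Λ → (sphere (0 : EuclideanSpace ℝ m) 1)) (s : Λ), ⟪((x s : (sphere (0 : EuclideanSpace ℝ m) 1)) : (EuclideanSpace ℝ m)), F x s⟫_ℝ = 0) (δ : ℝ) (z : (Λ → (sphere (0 : EuclideanSpace ℝ m) 1)) × (Λ → (EuclideanSpace ℝ m))) :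
    latticeTangentialize (latticeKick F δ z) = latticeKick F δ (latticeTangentialize z) := by
  refine Prod.ext rfl (funext fun s => ?_)
  change tangentialPart (z.1 s, z.2 s + δ • F z.1 s) = tangentialPart (z.1 s, z.2 s) + (δ • F z.1) s
  simp only [tangentialPart, Pi.smul_apply, inner_add_right, real_inner_smul_right, hF, mul_zero, add_zero]
  abel

omit [DecidableEq m] [Fintype Λ] in
/-- The lattice trajectory commutes with sitewise tangentialization (sitewise-tangent force). -/
theorem latticeTangentialize_leapfrog_pow {F : (Λ → (sphere (0 : EuclideanSpace ℝ m) 1)) → (Λ → (EuclideanSpace ℝ m))}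
    (hF : ∀ (x : Λ → (sphere (0 : EuclideanSpace ℝ m) 1)) (s : Λ), ⟪((x s : (sphere (0 : EuclideanSpace ℝ m) 1)) : (EuclideanSpace ℝ m)), F x s⟫_ℝ = 0) (δ : ℝ) :
    ∀ (n : ℕ) (z : (Λ → (sphere (0 : EuclideanSpace ℝ m) 1)) × (Λ → (EuclideanSpace ℝ m))),
      latticeTangentialize ((latticeLeapfrogPerm F δ ^ n) z) = (latticeLeapfrogPerm F δ ^ n) (latticeTangentialize z)
  | 0, z => by simp
  | n + 1, z => by
      rw [pow_succ', Equiv.Perm.mul_apply, Equiv.Perm.mul_apply]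
      have hstep : ∀ w : (Λ → (sphere (0 : EuclideanSpace ℝ m) 1)) × (Λ → (EuclideanSpace ℝ m)),
          latticeTangentialize (latticeLeapfrogPerm F δ w) = latticeLeapfrogPerm F δ (latticeTangentialize w) := by
        intro w
        change latticeTangentialize (latticeKick F (δ / 2) (latticeDrift δ (latticeKick F (δ / 2) w))) =
          latticeKick F (δ / 2) (latticeDrift δ (latticeKick F (δ / 2) (latticeTangentialize w)))
        rw [latticeTangentialize_latticeKick hF, latticeTangentialize_latticeDrift,
          latticeTangentialize_latticeKick hF]
      rw [hstep, latticeTangentialize_leapfrog_pow hF δ n z]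

omit [DecidableEq m] [Fintype Λ] in
/-- **The lattice proposal commutes with sitewise tangentialization.** -/
theorem latticeTangentialize_latticeProposal {F : (Λ → (sphere (0 : EuclideanSpace ℝ m) 1)) → (Λ → (EuclideanSpace ℝ m))}
    (hF : ∀ (x : Λ → (sphere (0 : EuclideanSpace ℝ m) 1)) (s : Λ), ⟪((x s : (sphere (0 : EuclideanSpace ℝ m) 1)) : (EuclideanSpace ℝ m)), F x s⟫_ℝ = 0) (δ : ℝ) (n : ℕ) (z : (Λ → (sphere (0 : EuclideanSpace ℝ m) 1)) × (Λ → (EuclideanSpace ℝ m))) :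
    latticeTangentialize (((latticeFlipPerm : Equiv.Perm ((Λ → (sphere (0 : EuclideanSpace ℝ m) 1)) × (Λ → (EuclideanSpace ℝ m)))) * latticeLeapfrogPerm F δ ^ n) z) =
      ((latticeFlipPerm : Equiv.Perm ((Λ → (sphere (0 : EuclideanSpace ℝ m) 1)) × (Λ → (EuclideanSpace ℝ m)))) * latticeLeapfrogPerm F δ ^ n) (latticeTangentialize z) := by
  rw [Equiv.Perm.mul_apply, Equiv.Perm.mul_apply]
  change latticeTangentialize (latticeFlip ((latticeLeapfrogPerm F δ ^ n) z)) =
    latticeFlip ((latticeLeapfrogPerm F δ ^ n) (latticeTangentialize z))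
  rw [latticeTangentialize_latticeFlip, latticeTangentialize_leapfrog_pow hF δ n z]

omit [DecidableEq m] [Fintype Λ] in
/-- The normal components are conserved sitewise along the lattice trajectory. -/
theorem inner_latticeLeapfrog_pow {F : (Λ → (sphere (0 : EuclideanSpace ℝ m) 1)) → (Λ → (EuclideanSpace ℝ m))}
    (hF : ∀ (x : Λ → (sphere (0 : EuclideanSpace ℝ m) 1)) (s : Λ), ⟪((x s : (sphere (0 : EuclideanSpace ℝ m) 1)) : (EuclideanSpace ℝ m)), F x s⟫_ℝ = 0) (δ : ℝ) (s : Λ) :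
    ∀ (n : ℕ) (z : (Λ → (sphere (0 : EuclideanSpace ℝ m) 1)) × (Λ → (EuclideanSpace ℝ m))),
      ⟪((((latticeLeapfrogPerm F δ ^ n) z).1 s : (sphere (0 : EuclideanSpace ℝ m) 1)) : (EuclideanSpace ℝ m)), ((latticeLeapfrogPerm F δ ^ n) z).2 s⟫_ℝ =
        ⟪((z.1 s : (sphere (0 : EuclideanSpace ℝ m) 1)) : (EuclideanSpace ℝ m)), z.2 s⟫_ℝ
  | 0, z => by simp
  | n + 1, z => by
      rw [pow_succ', Equiv.Perm.mul_apply]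
      have hK : ∀ (δ' : ℝ) (w : (Λ → (sphere (0 : EuclideanSpace ℝ m) 1)) × (Λ → (EuclideanSpace ℝ m))),
          ⟪(((latticeKick F δ' w).1 s : (sphere (0 : EuclideanSpace ℝ m) 1)) : (EuclideanSpace ℝ m)), (latticeKick F δ' w).2 s⟫_ℝ = ⟪((w.1 s : (sphere (0 : EuclideanSpace ℝ m) 1)) : (EuclideanSpace ℝ m)), w.2 s⟫_ℝ := by
        intro δ' w
        change ⟪((w.1 s : (sphere (0 : EuclideanSpace ℝ m) 1)) : (EuclideanSpace ℝ m)), (w.2 + δ' • F w.1) s⟫_ℝ = _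
        rw [Pi.add_apply, Pi.smul_apply, inner_add_right, real_inner_smul_right, hF, mul_zero, add_zero]
      have hD : ∀ w : (Λ → (sphere (0 : EuclideanSpace ℝ m) 1)) × (Λ → (EuclideanSpace ℝ m)),
          ⟪(((latticeDrift δ w).1 s : (sphere (0 : EuclideanSpace ℝ m) 1)) : (EuclideanSpace ℝ m)), (latticeDrift δ w).2 s⟫_ℝ = ⟪((w.1 s : (sphere (0 : EuclideanSpace ℝ m) 1)) : (EuclideanSpace ℝ m)), w.2 s⟫_ℝ :=
        fun w => inner_ambientDrift δ (w.1 s, w.2 s)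
      have hstep : ∀ w : (Λ → (sphere (0 : EuclideanSpace ℝ m) 1)) × (Λ → (EuclideanSpace ℝ m)),
          ⟪(((latticeLeapfrogPerm F δ w).1 s : (sphere (0 : EuclideanSpace ℝ m) 1)) : (EuclideanSpace ℝ m)), (latticeLeapfrogPerm F δ w).2 s⟫_ℝ = ⟪((w.1 s : (sphere (0 : EuclideanSpace ℝ m) 1)) : (EuclideanSpace ℝ m)), w.2 s⟫_ℝ := by
        intro w
        change ⟪(((latticeKick F (δ / 2) (latticeDrift δ (latticeKick F (δ / 2) w))).1 s : (sphere (0 : EuclideanSpace ℝ m) 1)) : (EuclideanSpace ℝ m)),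
          (latticeKick F (δ / 2) (latticeDrift δ (latticeKick F (δ / 2) w))).2 s⟫_ℝ = _
        rw [hK, hD, hK]
      rw [hstep, inner_latticeLeapfrog_pow hF δ s n z]

omit [DecidableEq m] [Fintype Λ] in
/-- … so their squares are conserved by the proposal (the flip negates them). -/
theorem inner_sq_latticeProposal {F : (Λ → (sphere (0 : EuclideanSpace ℝ m) 1)) → (Λ → (EuclideanSpace ℝ m))}
    (hF : ∀ (x : Λ → (sphere (0 : EuclideanSpace ℝ m) 1)) (s : Λ), ⟪((x s : (sphere (0 : EuclideanSpace ℝ m) 1)) : (EuclideanSpace ℝ m)), F x s⟫_ℝ = 0) (δ : ℝ) (n : ℕ) (s : Λ)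
    (z : (Λ → (sphere (0 : EuclideanSpace ℝ m) 1)) × (Λ → (EuclideanSpace ℝ m))) :
    ⟪(((((latticeFlipPerm : Equiv.Perm ((Λ → (sphere (0 : EuclideanSpace ℝ m) 1)) × (Λ → (EuclideanSpace ℝ m)))) * latticeLeapfrogPerm F δ ^ n) z).1 s : (sphere (0 : EuclideanSpace ℝ m) 1)) : (EuclideanSpace ℝ m)),
        (((latticeFlipPerm : Equiv.Perm ((Λ → (sphere (0 : EuclideanSpace ℝ m) 1)) × (Λ → (EuclideanSpace ℝ m)))) * latticeLeapfrogPerm F δ ^ n) z).2 s⟫_ℝ ^ 2 =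
      ⟪((z.1 s : (sphere (0 : EuclideanSpace ℝ m) 1)) : (EuclideanSpace ℝ m)), z.2 s⟫_ℝ ^ 2 := by
  rw [Equiv.Perm.mul_apply]
  change ⟪((((latticeLeapfrogPerm F δ ^ n) z).1 s : (sphere (0 : EuclideanSpace ℝ m) 1)) : (EuclideanSpace ℝ m)), (-((latticeLeapfrogPerm F δ ^ n) z).2) s⟫_ℝ ^ 2 = _
  rw [Pi.neg_apply, inner_neg_right, neg_sq, inner_latticeLeapfrog_pow hF δ s n z]

omit [DecidableEq m] in
/-- **The energy change does not see the normal components** (Gaussian kinetic energy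
`Σ_s ‖p_s‖²/2`, sitewise-tangent force). -/
theorem energyDiff_latticeProposal_tangentialize {F : (Λ → (sphere (0 : EuclideanSpace ℝ m) 1)) → (Λ → (EuclideanSpace ℝ m))}
    (hF : ∀ (x : Λ → (sphere (0 : EuclideanSpace ℝ m) 1)) (s : Λ), ⟪((x s : (sphere (0 : EuclideanSpace ℝ m) 1)) : (EuclideanSpace ℝ m)), F x s⟫_ℝ = 0) (δ : ℝ) (n : ℕ) (S : (Λ → (sphere (0 : EuclideanSpace ℝ m) 1)) → ℝ)
    (z : (Λ → (sphere (0 : EuclideanSpace ℝ m) 1)) × (Λ → (EuclideanSpace ℝ m))) :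
    (S z.1 + ∑ s, ‖z.2 s‖ ^ 2 / 2) -
        (S (((latticeFlipPerm : Equiv.Perm ((Λ → (sphere (0 : EuclideanSpace ℝ m) 1)) × (Λ → (EuclideanSpace ℝ m)))) * latticeLeapfrogPerm F δ ^ n) z).1 +
          ∑ s, ‖(((latticeFlipPerm : Equiv.Perm ((Λ → (sphere (0 : EuclideanSpace ℝ m) 1)) × (Λ → (EuclideanSpace ℝ m)))) * latticeLeapfrogPerm F δ ^ n) z).2 s‖ ^ 2 / 2) =
      (S (latticeTangentialize z).1 + ∑ s, ‖(latticeTangentialize z).2 s‖ ^ 2 / 2) -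
        (S (((latticeFlipPerm : Equiv.Perm ((Λ → (sphere (0 : EuclideanSpace ℝ m) 1)) × (Λ → (EuclideanSpace ℝ m)))) * latticeLeapfrogPerm F δ ^ n)
              (latticeTangentialize z)).1 +
          ∑ s, ‖(((latticeFlipPerm : Equiv.Perm ((Λ → (sphere (0 : EuclideanSpace ℝ m) 1)) × (Λ → (EuclideanSpace ℝ m)))) * latticeLeapfrogPerm F δ ^ n)
              (latticeTangentialize z)).2 s‖ ^ 2 / 2) := by
  set Ψ : Equiv.Perm ((Λ → (sphere (0 : EuclideanSpace ℝ m) 1)) × (Λ → (EuclideanSpace ℝ m))) :=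
    (latticeFlipPerm : Equiv.Perm ((Λ → (sphere (0 : EuclideanSpace ℝ m) 1)) × (Λ → (EuclideanSpace ℝ m)))) * latticeLeapfrogPerm F δ ^ n with hΨ
  have hcomm : latticeTangentialize (Ψ z) = Ψ (latticeTangentialize z) :=
    latticeTangentialize_latticeProposal hF δ n z
  have hpos : (Ψ (latticeTangentialize z)).1 = (Ψ z).1 := by rw [← hcomm]; rfl
  -- per-site splits ‖p_s‖² = ‖tangential‖² + normal²
  have e1 : ∀ s, ‖z.2 s‖ ^ 2 = ‖tangentialPart (z.1 s, z.2 s)‖ ^ 2 + ⟪((z.1 s : (sphere (0 : EuclideanSpace ℝ m) 1)) : (EuclideanSpace ℝ m)), z.2 s⟫_ℝ ^ 2 :=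
    fun s => norm_sq_eq_tangential_add_normal (z.1 s, z.2 s)
  have e2 : ∀ s, ‖(Ψ z).2 s‖ ^ 2 =
      ‖tangentialPart ((Ψ z).1 s, (Ψ z).2 s)‖ ^ 2 + ⟪(((Ψ z).1 s : (sphere (0 : EuclideanSpace ℝ m) 1)) : (EuclideanSpace ℝ m)), (Ψ z).2 s⟫_ℝ ^ 2 :=
    fun s => norm_sq_eq_tangential_add_normal ((Ψ z).1 s, (Ψ z).2 s)
  have e3 : ∀ s, ‖(latticeTangentialize z).2 s‖ ^ 2 = ‖tangentialPart (z.1 s, z.2 s)‖ ^ 2 :=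
    fun s => rfl
  have e4 : ∀ s, ‖(Ψ (latticeTangentialize z)).2 s‖ ^ 2 = ‖tangentialPart ((Ψ z).1 s, (Ψ z).2 s)‖ ^ 2 := by
    intro s
    have ht : tangentialPart ((Ψ (latticeTangentialize z)).1 s, (Ψ (latticeTangentialize z)).2 s) =
        tangentialPart ((Ψ z).1 s, (Ψ z).2 s) := by
      have := congrArg (fun w : (Λ → (sphere (0 : EuclideanSpace ℝ m) 1)) × (Λ → (EuclideanSpace ℝ m)) => w.2 s) hcomm
      simp only [latticeTangentialize_snd] at this
      rw [← this, hpos]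
      exact tangentialPart_of_inner_eq_zero (inner_tangentialPart' ((Ψ z).1 s) ((Ψ z).2 s))
    have hn : ⟪(((Ψ (latticeTangentialize z)).1 s : (sphere (0 : EuclideanSpace ℝ m) 1)) : (EuclideanSpace ℝ m)), (Ψ (latticeTangentialize z)).2 s⟫_ℝ ^ 2 = 0 := by
      rw [hΨ, inner_sq_latticeProposal hF δ n s (latticeTangentialize z), latticeTangentialize_snd,
        latticeTangentialize_fst, inner_tangentialPart', zero_pow two_ne_zero]
    rw [norm_sq_eq_tangential_add_normal ((Ψ (latticeTangentialize z)).1 s, (Ψ (latticeTangentialize z)).2 s),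
      ht, hn, add_zero]
  have n2 : ∀ s, ⟪(((Ψ z).1 s : (sphere (0 : EuclideanSpace ℝ m) 1)) : (EuclideanSpace ℝ m)), (Ψ z).2 s⟫_ℝ ^ 2 = ⟪((z.1 s : (sphere (0 : EuclideanSpace ℝ m) 1)) : (EuclideanSpace ℝ m)), z.2 s⟫_ℝ ^ 2 :=
    fun s => by rw [hΨ]; exact inner_sq_latticeProposal hF δ n s z
  rw [hpos, latticeTangentialize_fst]
  simp only [e1, e2, e3, e4, n2, Finset.sum_add_distrib, add_div]
  ring

variable [Nonempty m]

/-- **The normal components are inert on the lattice**: the configuration marginal of one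
phase-space update from `(x, p)` equals the one from the sitewise-tangentialized start. -/
theorem latticeHMC_fst_apply_eq_tangentialize (h2 : 2 ≤ Fintype.card m) {S : (Λ → (sphere (0 : EuclideanSpace ℝ m) 1)) → ℝ}
    (hS : Measurable S) {F : (Λ → (sphere (0 : EuclideanSpace ℝ m) 1)) → (Λ → (EuclideanSpace ℝ m))} (hFm : Measurable F)
    (hF : ∀ (x : Λ → (sphere (0 : EuclideanSpace ℝ m) 1)) (s : Λ), ⟪((x s : (sphere (0 : EuclideanSpace ℝ m) 1)) : (EuclideanSpace ℝ m)), F x s⟫_ℝ = 0) (δ : ℝ) (n : ℕ)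
    (z : (Λ → (sphere (0 : EuclideanSpace ℝ m) 1)) × (Λ → (EuclideanSpace ℝ m))) {A : Set (Λ → (sphere (0 : EuclideanSpace ℝ m) 1))} (hA : MeasurableSet A) :
    involMH ⇑((latticeFlipPerm : Equiv.Perm ((Λ → (sphere (0 : EuclideanSpace ℝ m) 1)) × (Λ → (EuclideanSpace ℝ m)))) * latticeLeapfrogPerm F δ ^ n)
        (measurePreserving_latticeProposal h2 hFm δ n).measurable
        (fun w : (Λ → (sphere (0 : EuclideanSpace ℝ m) 1)) × (Λ → (EuclideanSpace ℝ m)) => S w.1 + ∑ s, ‖w.2 s‖ ^ 2 / 2) z (Prod.fst ⁻¹' A) =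
      involMH ⇑((latticeFlipPerm : Equiv.Perm ((Λ → (sphere (0 : EuclideanSpace ℝ m) 1)) × (Λ → (EuclideanSpace ℝ m)))) * latticeLeapfrogPerm F δ ^ n)
        (measurePreserving_latticeProposal h2 hFm δ n).measurable
        (fun w : (Λ → (sphere (0 : EuclideanSpace ℝ m) 1)) × (Λ → (EuclideanSpace ℝ m)) => S w.1 + ∑ s, ‖w.2 s‖ ^ 2 / 2) (latticeTangentialize z)
        (Prod.fst ⁻¹' A) := by
  have hT : Measurable fun p : Λ → (EuclideanSpace ℝ m) => ∑ s, ‖p s‖ ^ 2 / 2 :=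
    (continuous_finsetSum _ fun s _ => (((continuous_apply s).norm).pow 2).div_const 2).measurable
  have hH : Measurable fun w : (Λ → (sphere (0 : EuclideanSpace ℝ m) 1)) × (Λ → (EuclideanSpace ℝ m)) => S w.1 + ∑ s, ‖w.2 s‖ ^ 2 / 2 :=
    (hS.comp measurable_fst).add (hT.comp measurable_snd)
  have hB : MeasurableSet (Prod.fst ⁻¹' A : Set ((Λ → (sphere (0 : EuclideanSpace ℝ m) 1)) × (Λ → (EuclideanSpace ℝ m)))) := measurable_fst hA
  rw [involMH_apply hH z hB, involMH_apply hH (latticeTangentialize z) hB]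
  have hacc : involAcceptE (fun w : (Λ → (sphere (0 : EuclideanSpace ℝ m) 1)) × (Λ → (EuclideanSpace ℝ m)) => S w.1 + ∑ s, ‖w.2 s‖ ^ 2 / 2)
      ⇑((latticeFlipPerm : Equiv.Perm ((Λ → (sphere (0 : EuclideanSpace ℝ m) 1)) × (Λ → (EuclideanSpace ℝ m)))) * latticeLeapfrogPerm F δ ^ n) z =
      involAcceptE (fun w : (Λ → (sphere (0 : EuclideanSpace ℝ m) 1)) × (Λ → (EuclideanSpace ℝ m)) => S w.1 + ∑ s, ‖w.2 s‖ ^ 2 / 2)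
      ⇑((latticeFlipPerm : Equiv.Perm ((Λ → (sphere (0 : EuclideanSpace ℝ m) 1)) × (Λ → (EuclideanSpace ℝ m)))) * latticeLeapfrogPerm F δ ^ n)
      (latticeTangentialize z) := by
    simp only [involAcceptE, involAccept]
    rw [energyDiff_latticeProposal_tangentialize hF δ n S z]
  have hpos : (((latticeFlipPerm : Equiv.Perm ((Λ → (sphere (0 : EuclideanSpace ℝ m) 1)) × (Λ → (EuclideanSpace ℝ m)))) * latticeLeapfrogPerm F δ ^ n)
      (latticeTangentialize z)).1 =
      (((latticeFlipPerm : Equiv.Perm ((Λ → (sphere (0 : EuclideanSpace ℝ m) 1)) × (Λ → (EuclideanSpace ℝ m)))) * latticeLeapfrogPerm F δ ^ n) z).1 := by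
    rw [← latticeTangentialize_latticeProposal hF δ n z]; rfl
  have key : ∀ w : (Λ → (sphere (0 : EuclideanSpace ℝ m) 1)) × (Λ → (EuclideanSpace ℝ m)),
      (Prod.fst ⁻¹' A : Set ((Λ → (sphere (0 : EuclideanSpace ℝ m) 1)) × (Λ → (EuclideanSpace ℝ m)))).indicator (1 : (Λ → (sphere (0 : EuclideanSpace ℝ m) 1)) × (Λ → (EuclideanSpace ℝ m)) → ℝ≥0∞) w =
      A.indicator (1 : (Λ → (sphere (0 : EuclideanSpace ℝ m) 1)) → ℝ≥0∞) w.1 := fun w =>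
    Set.indicator_comp_right (Prod.fst : (Λ → (sphere (0 : EuclideanSpace ℝ m) 1)) × (Λ → (EuclideanSpace ℝ m)) → (Λ → (sphere (0 : EuclideanSpace ℝ m) 1))) (g := (1 : (Λ → (sphere (0 : EuclideanSpace ℝ m) 1)) → ℝ≥0∞))
  rw [hacc, key, key, key, key, hpos, latticeTangentialize_fst]

/-- **The lattice tangent momentum law**: the image of a momentum law `μP` on `(ℝ^d)^Λ` under the
sitewise tangential projection at the configuration `x`, as a kernel. -/
def latticeTangentMomentumLaw (μP : Measure (Λ → (EuclideanSpace ℝ m))) : Kernel (Λ → (sphere (0 : EuclideanSpace ℝ m) 1)) (Λ → (EuclideanSpace ℝ m)) :=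
  Kernel.map (Kernel.id ×ₖ Kernel.const (Λ → (sphere (0 : EuclideanSpace ℝ m) 1)) μP)
    (fun z : (Λ → (sphere (0 : EuclideanSpace ℝ m) 1)) × (Λ → (EuclideanSpace ℝ m)) => (latticeTangentialize z).2)

omit [DecidableEq m] [Nonempty m] [Fintype Λ] in
/-- The sitewise tangential projection is measurable. -/
theorem measurable_latticeTangentialize_snd :
    Measurable fun z : (Λ → (sphere (0 : EuclideanSpace ℝ m) 1)) × (Λ → (EuclideanSpace ℝ m)) => (latticeTangentialize z).2 := by
  refine measurable_pi_iff.2 fun s => ?_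
  change Measurable fun z : (Λ → (sphere (0 : EuclideanSpace ℝ m) 1)) × (Λ → (EuclideanSpace ℝ m)) => tangentialPart (z.1 s, z.2 s)
  exact continuous_tangentialPart.measurable.comp
    (((measurable_pi_apply s).comp measurable_fst).prodMk ((measurable_pi_apply s).comp measurable_snd))

omit [DecidableEq m] [Nonempty m] [Fintype Λ] in
/-- Its value at `x` is the image law. -/
theorem latticeTangentMomentumLaw_apply (μP : Measure (Λ → (EuclideanSpace ℝ m))) [SFinite μP] (x : Λ → (sphere (0 : EuclideanSpace ℝ m) 1)) :
    latticeTangentMomentumLaw μP x = μP.map fun p : Λ → (EuclideanSpace ℝ m) => (latticeTangentialize (x, p)).2 := by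
  rw [latticeTangentMomentumLaw, Kernel.map_apply _ measurable_latticeTangentialize_snd, Kernel.prod_apply,
    Kernel.id_apply, Kernel.const_apply, Measure.dirac_prod,
    Measure.map_map measurable_latticeTangentialize_snd measurable_prodMk_left]
  rfl

omit [DecidableEq m] [Nonempty m] [Fintype Λ] in
/-- It is s-finite for an s-finite law. -/
instance latticeTangentMomentumLaw.isSFiniteKernel (μP : Measure (Λ → (EuclideanSpace ℝ m))) [SFinite μP] :
    IsSFiniteKernel (latticeTangentMomentumLaw (m := m) μP) := by
  unfold latticeTangentMomentumLaw; infer_instance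

omit [DecidableEq m] [Nonempty m] [Fintype Λ] in
/-- It is Markov for a probability law. -/
instance latticeTangentMomentumLaw.isMarkovKernel (μP : Measure (Λ → (EuclideanSpace ℝ m))) [IsProbabilityMeasure μP] :
    IsMarkovKernel (latticeTangentMomentumLaw (m := m) μP) := by
  unfold latticeTangentMomentumLaw
  exact Kernel.IsMarkovKernel.map _ measurable_latticeTangentialize_snd

/-- **Lattice HMC with ambient momenta = lattice HMC with sitewise tangent momenta, on
configurations** (sitewise-tangent force, Gaussian kinetic energy `Σ_s ‖p_s‖²/2`). -/
theorem latticeHMC_config_eq_tangentRefresh (h2 : 2 ≤ Fintype.card m) {S : (Λ → (sphere (0 : EuclideanSpace ℝ m) 1)) → ℝ}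
    (hS : Measurable S) {F : (Λ → (sphere (0 : EuclideanSpace ℝ m) 1)) → (Λ → (EuclideanSpace ℝ m))} (hFm : Measurable F)
    (hF : ∀ (x : Λ → (sphere (0 : EuclideanSpace ℝ m) 1)) (s : Λ), ⟪((x s : (sphere (0 : EuclideanSpace ℝ m) 1)) : (EuclideanSpace ℝ m)), F x s⟫_ℝ = 0) (δ : ℝ) (n : ℕ)
    (μP : Measure (Λ → (EuclideanSpace ℝ m))) [SFinite μP] :
    refreshUpdate
        (involMH ⇑((latticeFlipPerm : Equiv.Perm ((Λ → (sphere (0 : EuclideanSpace ℝ m) 1)) × (Λ → (EuclideanSpace ℝ m)))) * latticeLeapfrogPerm F δ ^ n)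
          (measurePreserving_latticeProposal h2 hFm δ n).measurable
          (fun w : (Λ → (sphere (0 : EuclideanSpace ℝ m) 1)) × (Λ → (EuclideanSpace ℝ m)) => S w.1 + ∑ s, ‖w.2 s‖ ^ 2 / 2)) μP =
      refreshUpdateK
        (involMH ⇑((latticeFlipPerm : Equiv.Perm ((Λ → (sphere (0 : EuclideanSpace ℝ m) 1)) × (Λ → (EuclideanSpace ℝ m)))) * latticeLeapfrogPerm F δ ^ n)
          (measurePreserving_latticeProposal h2 hFm δ n).measurable
          (fun w : (Λ → (sphere (0 : EuclideanSpace ℝ m) 1)) × (Λ → (EuclideanSpace ℝ m)) => S w.1 + ∑ s, ‖w.2 s‖ ^ 2 / 2))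
        (latticeTangentMomentumLaw μP) := by
  ext x A hA
  have hk : Measurable fun p : Λ → (EuclideanSpace ℝ m) =>
      involMH ⇑((latticeFlipPerm : Equiv.Perm ((Λ → (sphere (0 : EuclideanSpace ℝ m) 1)) × (Λ → (EuclideanSpace ℝ m)))) * latticeLeapfrogPerm F δ ^ n)
        (measurePreserving_latticeProposal h2 hFm δ n).measurable
        (fun w : (Λ → (sphere (0 : EuclideanSpace ℝ m) 1)) × (Λ → (EuclideanSpace ℝ m)) => S w.1 + ∑ s, ‖w.2 s‖ ^ 2 / 2) (x, p) (Prod.fst ⁻¹' A) :=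
    (Kernel.measurable_coe _ (measurable_fst hA)).comp measurable_prodMk_left
  have hT : Measurable fun p : Λ → (EuclideanSpace ℝ m) => (latticeTangentialize (x, p)).2 :=
    measurable_latticeTangentialize_snd.comp measurable_prodMk_left
  rw [refreshUpdate_apply' _ _ _ hA, refreshUpdateK_apply' _ _ x hA, latticeTangentMomentumLaw_apply,
    lintegral_map hk hT]
  refine lintegral_congr fun p => ?_
  exact latticeHMC_fst_apply_eq_tangentialize h2 hS hFm hF δ n (x, p) hA

/-- **THE CP(N−1)/O(N) HMC AS THE CODE RUNS IT IS EXACT**: sitewise tangent Gaussian momenta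
(the product Gaussian of `(ℝ^d)^Λ` projected to the tangent spaces), `n` lattice-leapfrog steps with
the exact geodesic site update and a sitewise-tangent site-coupling force, momentum flip, Metropolis
with `H = S + Σ_s ‖p_s‖²/2`, momenta forgotten: `e^{−S}·uniformSphere^Λ` is invariant. -/
theorem lattice_sphere_hmc_tangentGaussian_exact (h2 : 2 ≤ Fintype.card m) {S : (Λ → (sphere (0 : EuclideanSpace ℝ m) 1)) → ℝ}
    (hS : Measurable S) {F : (Λ → (sphere (0 : EuclideanSpace ℝ m) 1)) → (Λ → (EuclideanSpace ℝ m))} (hFm : Measurable F)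
    (hF : ∀ (x : Λ → (sphere (0 : EuclideanSpace ℝ m) 1)) (s : Λ), ⟪((x s : (sphere (0 : EuclideanSpace ℝ m) 1)) : (EuclideanSpace ℝ m)), F x s⟫_ℝ = 0) (δ : ℝ) (n : ℕ) :
    Kernel.Invariant
      (refreshUpdateK
        (involMH ⇑((latticeFlipPerm : Equiv.Perm ((Λ → (sphere (0 : EuclideanSpace ℝ m) 1)) × (Λ → (EuclideanSpace ℝ m)))) * latticeLeapfrogPerm F δ ^ n)
          (measurePreserving_latticeProposal h2 hFm δ n).measurable
          (fun w : (Λ → (sphere (0 : EuclideanSpace ℝ m) 1)) × (Λ → (EuclideanSpace ℝ m)) => S w.1 + ∑ s, ‖w.2 s‖ ^ 2 / 2))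
        (latticeTangentMomentumLaw
          ((((Measure.pi fun _ : Λ => (volume : Measure (EuclideanSpace ℝ m))).withDensity
              (fun p => ENNReal.ofReal (Real.exp (-(∑ s, ‖p s‖ ^ 2 / 2)))) Set.univ)⁻¹ •
            (Measure.pi fun _ : Λ => (volume : Measure (EuclideanSpace ℝ m))).withDensity
              (fun p => ENNReal.ofReal (Real.exp (-(∑ s, ‖p s‖ ^ 2 / 2))))))))
      ((Measure.pi fun _ : Λ => uniformSphere (volume : Measure (EuclideanSpace ℝ m))).withDensity
        fun x => ENNReal.ofReal (Real.exp (-S x))) := by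
  rw [← latticeHMC_config_eq_tangentRefresh h2 hS hFm hF δ n]
  exact lattice_sphere_hmc_gaussian_exact h2 hS hFm δ n

end LatticeTangential

end Summit.Ventures.LatticeQCDFlow.Exactness

end
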